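import Mathlib
import Literature.Analysis.ODE.InverseSquareLadder
import Literature.Analysis.ODE.InverseSquareLadderExpansion
import Literature.Analysis.ODE.InverseSquareLadderAsymptotics
import Literature.Analysis.PDE.InverseSquareLadderWave
import HarnessLib

/-!
# Exterior channel energy of exact inverse-square waves with compactly perturbed profiles

Analysis/PDE support file (everything proved). For `ι` smooth with `ι = 1/x` on `[½,∞)` and a free
wave `Φ(t,x) = F(x−t) + G(x+t)` whose profiles `F, G ∈ C^{n+2}` are constant on `[B,∞)` with
`F + G = 0` there, `ψ(t,·) = ladder ι n (Φ(t,·))` solves `ψ_tt − ψ_xx + n(n+1)x⁻²ψ = 0` on `x > ½`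
(`InverseSquareLadderWave.lean`), vanishes for `x > B + t`, and for `1 ≤ R ≤ B`
`∫_{x>R+t} (ψ_t² + ψ_x² + n(n+1)ι²ψ²)(t,x) dx → 2∫_R^B (F^{(n+1)})²` as `t → +∞`
(`inverseSquare_channel_limit_atTop`): in the window `x = y + t` the ladder equals `F^{(n)}(y)` up
to terms with a factor `1/(y+t)` (`InverseSquareLadderExpansion/Asymptotics`), then dominated
convergence on `[R,B]`. This is the 1D (Regge–Wheeler variable) form of the odd-dimensional radial
exterior-energy computation of Kenig–Lawrie–Liu–Schlag (2015) for generic compactly supported data;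
channel half of the far-side estimate of `FixedModeChannels` (route PhotonSphereChannels,
stmt-FinalStateConjecture-10048).
-/

noncomputable section

namespace Literature.Analysis.PDE

open Set Filter Topology MeasureTheory Finset Literature.Analysis.ODE

variable {ι : ℝ → ℝ}

/-- **Exterior channel energy of exact inverse-square waves, `t → +∞`.** See the module docstring.
[cite: KenigEtAl2015, Theorem 5 (exterior energy, odd d)] -/
theorem inverseSquare_channel_limit_atTop (hι : ContDiff ℝ (⊤ : ℕ∞) ι)
    (hιeq : ∀ x : ℝ, 1 / 2 ≤ x → ι x = x⁻¹) (n : ℕ) {F G : ℝ → ℝ}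
    (hF : ContDiff ℝ ((n + 2 : ℕ) : ℕ∞) F) (hG : ContDiff ℝ ((n + 2 : ℕ) : ℕ∞) G) {R B : ℝ}
    (hR : 1 ≤ R) (hRB : R ≤ B) (hFB : ∀ x, B ≤ x → F x = F B) (hGB : ∀ x, B ≤ x → G x = -F B)
    {Φ : ℝ → ℝ → ℝ} (hΦ : ∀ t x, Φ t x = F (x - t) + G (x + t)) :
    Tendsto (fun t => ∫ x in Ioi (R + t),
        (deriv (fun τ => ladder ι n (Φ τ) x) t ^ 2 + deriv (ladder ι n (Φ t)) x ^ 2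
          + (n : ℝ) * (n + 1) * ι x ^ 2 * ladder ι n (Φ t) x ^ 2)) atTop
      (𝓝 (2 * ∫ y in R..B, iteratedDeriv (n + 1) F y ^ 2)) := by
  -- Step 0: the Riccati set, expansions, regularity
  set S : Set ℝ := Ioi (1 / 2) with hS
  have hSo : IsOpen S := isOpen_Ioi
  have hric : ∀ x ∈ S, deriv ι x = -(ι x) ^ 2 := by
    intro x hx
    have hx' : (1 / 2 : ℝ) < x := hx
    have hx0 : x ≠ 0 := by intro h; rw [h] at hx'; norm_num at hx'
    have hev : ι =ᶠ[𝓝 x] fun y => y⁻¹ :=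
      Filter.mem_of_superset (Ioi_mem_nhds hx') fun y hy => hιeq y (le_of_lt hy)
    rw [hev.deriv_eq, deriv_inv, hιeq x hx'.le]; field_simp
  obtain ⟨β, hβn, hexpβ⟩ := exists_ladder_expansion hι hSo hric n
  obtain ⟨γ, hγn, hexpγ⟩ := exists_ladder_expansion hι hSo hric (n + 1)
  have hΦC : ContDiff ℝ ((n + 2 : ℕ) : ℕ∞) (Function.uncurry Φ) := by
    have : Function.uncurry Φ = fun p : ℝ × ℝ => F (p.2 - p.1) + G (p.2 + p.1) := by
      funext p; exact hΦ p.1 p.2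
    rw [this]
    exact (hF.comp (contDiff_snd.sub contDiff_fst)).add (hG.comp (contDiff_snd.add contDiff_fst))
  -- the shifted profile `w = F − F(B)` vanishes on `[B, ∞)`
  set w : ℝ → ℝ := fun z => F z - F B with hw
  have hwC : ContDiff ℝ ((n + 2 : ℕ) : ℕ∞) w := hF.sub contDiff_const
  have hwB : ∀ z, B ≤ z → w z = 0 := fun z hz => by simp only [hw, hFB z hz, sub_self]
  have hw_ev0 : ∀ z, B < z → w =ᶠ[𝓝 z] fun _ => 0 := fun z hz =>
    Filter.mem_of_superset (Ioi_mem_nhds hz) fun y hy => hwB y (le_of_lt hy)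
  have hwj0 : ∀ j z, B < z → iteratedDeriv j w z = 0 := by
    intro j z hz
    rw [(hw_ev0 z hz).iteratedDeriv_eq j, iteratedDeriv_const]
    simp
  have hdw : ∀ j, iteratedDeriv (j + 1) w = iteratedDeriv (j + 1) F := by
    intro j
    rw [iteratedDeriv_succ', iteratedDeriv_succ' (f := F)]
    congr 1; funext z
    simp only [hw, deriv_sub_const]
  have hG'0 : ∀ z, B < z → deriv G z = 0 := by
    intro z hz
    have hev : G =ᶠ[𝓝 z] fun _ => -F B :=
      Filter.mem_of_superset (Ioi_mem_nhds hz) fun y hy => hGB y (le_of_lt hy)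
    rw [hev.deriv_eq, deriv_const]
  have hF'0 : ∀ z, B < z → deriv F z = 0 := by
    intro z hz
    have hev : F =ᶠ[𝓝 z] fun _ => F B :=
      Filter.mem_of_superset (Ioi_mem_nhds hz) fun y hy => hFB y (le_of_lt hy)
    rw [hev.deriv_eq, deriv_const]
  -- Step 1: uniform bounds for the jets of `w` on `[R, B]` and for the coefficient tables
  obtain ⟨M, hM⟩ : ∃ M : ℝ, ∀ y ∈ Icc R B, ∀ j ∈ range (n + 3), |iteratedDeriv j w y| ≤ M := by
    have hc : ContinuousOn (fun y => ∑ j ∈ range (n + 3), |iteratedDeriv j w y|) (Icc R B) := by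
      refine (continuous_finsetSum _ fun j hj => ?_).continuousOn
      have hjle : (j : ℕ∞) ≤ (n + 2 : ℕ) := by
        exact_mod_cast Nat.lt_succ_iff.1 (mem_range.1 hj)
      exact (hwC.continuous_iteratedDeriv j (by exact_mod_cast hjle)).abs
    obtain ⟨M, hM⟩ := isCompact_Icc.exists_bound_of_continuousOn hc
    refine ⟨M, fun y hy j hj => ?_⟩
    have h := hM y hy
    rw [Real.norm_eq_abs, Finset.abs_sum_of_nonneg (fun i _ => abs_nonneg _)] at h
    exact (Finset.single_le_sum (fun i _ => abs_nonneg (iteratedDeriv i w y)) hj).trans h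
  have hM0 : 0 ≤ M := (abs_nonneg _).trans (hM R ⟨le_rfl, hRB⟩ 0 (by simp))
  set b : ℝ := ∑ j ∈ range (n + 2), (|β j| + |γ j|) with hb
  have hb0 : 0 ≤ b := Finset.sum_nonneg fun j _ => by positivity
  have hbj : ∀ j ∈ range (n + 2), |β j| + |γ j| ≤ b := fun j hj =>
    Finset.single_le_sum (f := fun i => |β i| + |γ i|) (fun i _ => by positivity) hj
  have hβb : ∀ j ∈ range (n + 2), |β j| ≤ b := fun j hj => by
    linarith [hbj j hj, abs_nonneg (γ j)]
  have hγb : ∀ j ∈ range (n + 2), |γ j| ≤ b := fun j hj => by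
    linarith [hbj j hj, abs_nonneg (β j)]
  -- Step 2: the solution in the exterior region `x > R + t`, `t ≥ t₀`
  set t₀ : ℝ := B - R + 1 with ht₀
  set u : ℝ → ℝ → ℝ := fun t x => w (x - t) with hu
  set v : ℝ → ℝ → ℝ := fun t x => deriv F (x - t) with hv
  have huC : ∀ t, ContDiff ℝ ((n + 2 : ℕ) : ℕ∞) (u t) := fun t =>
    hwC.comp (contDiff_id.sub contDiff_const)
  have hFd : Differentiable ℝ F := hF.differentiable (by simp)
  have hGd : Differentiable ℝ G := hG.differentiable (by simp)
  have hF1 : ContDiff ℝ ((n + 1 : ℕ) : ℕ∞) (deriv F) := by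
    have h := (contDiff_succ_iff_deriv.1 (by exact_mod_cast hF :
      ContDiff ℝ ((((n + 1 : ℕ) : ℕ∞) : WithTop ℕ∞) + 1) F)).2.2
    exact_mod_cast h
  have hvC : ∀ t, ContDiff ℝ ((n + 1 : ℕ) : ℕ∞) (v t) := fun t =>
    hF1.comp (contDiff_id.sub contDiff_const)
  -- (a) `Φ(t,·) = u t` near every exterior point
  have hΦu : ∀ t, t₀ ≤ t → ∀ x, R + t < x → Φ t =ᶠ[𝓝 x] u t := by
    intro t ht x hx
    have hBx : B - t < x := by rw [ht₀] at ht; linarith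
    refine Filter.mem_of_superset (Ioi_mem_nhds hBx) fun x' hx' => ?_
    have hx'' : B ≤ x' + t := by have := Set.mem_Ioi.1 hx'; linarith
    show Φ t x' = w (x' - t)
    rw [hΦ, hGB _ hx'', hw]; ring
  -- (b) time derivative of `Φ` near exterior points
  have hΦt : ∀ t y, deriv (fun τ => Φ τ y) t = -deriv F (y - t) + deriv G (y + t) := by
    intro t y
    have h1 : HasDerivAt (fun τ => F (y - τ)) (deriv F (y - t) * (0 - 1)) t :=
      (hFd (y - t)).hasDerivAt.comp t ((hasDerivAt_const t y).sub (hasDerivAt_id t))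
    have h2 : HasDerivAt (fun τ => G (y + τ)) (deriv G (y + t) * (0 + 1)) t :=
      (hGd (y + t)).hasDerivAt.comp t ((hasDerivAt_const t y).add (hasDerivAt_id t))
    have h : HasDerivAt (fun τ => Φ τ y)
        (deriv F (y - t) * (0 - 1) + deriv G (y + t) * (0 + 1)) t := by
      have e : (fun τ => Φ τ y) = fun τ => F (y - τ) + G (y + τ) := funext fun τ => hΦ τ y
      rw [e]; exact h1.add h2
    rw [h.deriv]; ring
  have hΦtv : ∀ t, t₀ ≤ t → ∀ x, R + t < x →
      (fun y => deriv (fun τ => Φ τ y) t) =ᶠ[𝓝 x] fun y => (-1) * v t y := by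
    intro t ht x hx
    have hBx : B - t < x := by rw [ht₀] at ht; linarith
    refine Filter.mem_of_superset (Ioi_mem_nhds hBx) fun y hy => ?_
    have hy' : B < y + t := by have := Set.mem_Ioi.1 hy; linarith
    show deriv (fun τ => Φ τ y) t = (-1) * v t y
    rw [hΦt, hG'0 _ hy', hv]; ring
  -- (c) the three quantities in the exterior region
  have hψ_eq : ∀ t, t₀ ≤ t → ∀ x, R + t < x → ladder ι n (Φ t) x = ladder ι n (u t) x :=
    fun t ht x hx => ladder_congr_of_eventuallyEq (hΦu t ht x hx) n
  have hψx_eq : ∀ t, t₀ ≤ t → ∀ x, R + t < x → deriv (ladder ι n (Φ t)) x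
      = ladder ι (n + 1) (u t) x + ((n : ℝ) + 1) * ι x * ladder ι n (u t) x := by
    intro t ht x hx
    rw [(ladder_eventuallyEq (hΦu t ht x hx) n).deriv_eq, ladder_succ, ladderStep_apply]
    push_cast; ring
  have hψt_eq : ∀ t, t₀ ≤ t → ∀ x, R + t < x →
      deriv (fun τ => ladder ι n (Φ τ) x) t = -ladder ι n (v t) x := by
    intro t ht x hx
    rw [deriv_ladder_param hι hΦC t x, ladder_congr_of_eventuallyEq (hΦtv t ht x hx) n,
      ladder_const_mul]
    ring
  have hju : ∀ t j x, iteratedDeriv j (u t) x = iteratedDeriv j w (x - t) := by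
    intro t j x
    simp only [hu, iteratedDeriv_comp_sub_const]
  have hjv : ∀ t j x, iteratedDeriv j (v t) x = iteratedDeriv (j + 1) w (x - t) := by
    intro t j x
    have e : v t = fun x => deriv F (x - t) := rfl
    rw [e, iteratedDeriv_comp_sub_const, hdw j, iteratedDeriv_succ']
  -- (e) error terms and their bounds on the window
  set K : ℝ := ((n : ℝ) + 1) * b * M with hK
  have hK0 : 0 ≤ K := by positivity
  set ε₁ : ℝ → ℝ → ℝ := fun t y => ladder ι n (u t) (y + t) - iteratedDeriv n w y with hε₁
  set ε₂ : ℝ → ℝ → ℝ := fun t y => ladder ι (n + 1) (u t) (y + t) - iteratedDeriv (n + 1) w y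
    with hε₂
  set ε₄ : ℝ → ℝ → ℝ := fun t y => ladder ι n (v t) (y + t) - iteratedDeriv (n + 1) w y with hε₄
  have hwin : ∀ t, t₀ ≤ t → ∀ y ∈ Ioc R B,
      |ε₁ t y| ≤ K / (y + t) ∧ |ε₂ t y| ≤ K / (y + t) ∧ |ε₄ t y| ≤ K / (y + t) := by
    intro t ht y hy
    have hyR : R < y := hy.1
    have ht1 : 1 ≤ t := by rw [ht₀] at ht; linarith
    have hz1 : 1 ≤ y + t := by linarith
    have hzS : y + t ∈ S := show (1 / 2 : ℝ) < y + t by linarith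
    have hιz : ι (y + t) = (y + t)⁻¹ := hιeq _ (by linarith)
    have hyI : y ∈ Icc R B := ⟨hy.1.le, hy.2⟩
    have hz0 : 0 < y + t := by linarith
    -- generic estimate of a weighted jet sum
    have hsum : ∀ (c : ℕ → ℝ) (m : ℕ), m ≤ n + 1 → (∀ j ∈ range (n + 2), |c j| ≤ b) →
        ∀ s : ℕ, s ≤ 1 →
        (∑ j ∈ range m, |c j| * |iteratedDeriv (j + s) w y|) ≤ K := by
      intro c m hm hc s hs
      calc (∑ j ∈ range m, |c j| * |iteratedDeriv (j + s) w y|)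
          ≤ ∑ j ∈ range m, b * M := by
            refine sum_le_sum fun j hj => ?_
            have hjm : j < m := mem_range.1 hj
            exact mul_le_mul (hc j (mem_range.2 (by omega))) (hM y hyI (j + s)
              (mem_range.2 (by omega))) (abs_nonneg _) hb0
        _ = m * (b * M) := by rw [sum_const, card_range, nsmul_eq_mul]
        _ ≤ ((n : ℝ) + 1) * (b * M) := by
            refine mul_le_mul_of_nonneg_right ?_ (by positivity)
            exact_mod_cast hm
        _ = K := by rw [hK]; ring
    refine ⟨?_, ?_, ?_⟩
    · have h := abs_ladder_sub_iteratedDeriv_le hβn hz1 hιz (hexpβ (u t) ((huC t).of_le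
        (by exact_mod_cast (by omega : n ≤ n + 2))) _ hzS)
      simp only [hju, add_sub_cancel_right] at h
      refine h.trans (div_le_div_of_nonneg_right ?_ hz0.le)
      have := hsum β n (Nat.le_succ n) hβb 0 zero_le_one
      simpa using this
    · have h := abs_ladder_sub_iteratedDeriv_le hγn hz1 hιz (hexpγ (u t) ((huC t).of_le
        (by exact_mod_cast (by omega : n + 1 ≤ n + 2))) _ hzS)
      simp only [hju, add_sub_cancel_right] at h
      refine h.trans (div_le_div_of_nonneg_right ?_ hz0.le)
      have := hsum γ (n + 1) le_rfl hγb 0 zero_le_one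
      simpa using this
    · have h := abs_ladder_sub_iteratedDeriv_le hβn hz1 hιz (hexpβ (v t) ((hvC t).of_le
        (by exact_mod_cast (by omega : n ≤ n + 1))) _ hzS)
      simp only [hjv, add_sub_cancel_right] at h
      refine h.trans (div_le_div_of_nonneg_right ?_ hz0.le)
      exact hsum β n (Nat.le_succ n) hβb 1 le_rfl
  -- Step 3: nothing beyond `x = B + t`; the exterior energy as a window integral
  have hlad0 : ∀ m : ℕ, ladder ι m (fun _ : ℝ => (0 : ℝ)) = fun _ => 0 := by
    intro m
    induction m with
    | zero => rfl
    | succ m ih =>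
      rw [ladder_succ, ih]; funext x; simp [ladderStep_apply]
  have hzero : ∀ t, t₀ ≤ t → ∀ x, B + t < x →
      ladder ι n (u t) x = 0 ∧ ladder ι (n + 1) (u t) x = 0 ∧ ladder ι n (v t) x = 0 := by
    intro t _ x hx
    have hu0 : u t =ᶠ[𝓝 x] fun _ => 0 := by
      refine Filter.mem_of_superset (Ioi_mem_nhds hx) fun x' hx' => ?_
      have h' := Set.mem_Ioi.1 hx'
      show w (x' - t) = 0
      exact hwB _ (by linarith)
    have hv0 : v t =ᶠ[𝓝 x] fun _ => 0 := by
      refine Filter.mem_of_superset (Ioi_mem_nhds hx) fun x' hx' => ?_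
      have h' := Set.mem_Ioi.1 hx'
      show deriv F (x' - t) = 0
      exact hF'0 _ (by linarith)
    refine ⟨?_, ?_, ?_⟩
    · rw [ladder_congr_of_eventuallyEq hu0 n, hlad0]
    · rw [ladder_congr_of_eventuallyEq hu0 (n + 1), hlad0]
    · rw [ladder_congr_of_eventuallyEq hv0 n, hlad0]
  set et : ℝ → ℝ → ℝ := fun t x =>
    deriv (fun τ => ladder ι n (Φ τ) x) t ^ 2 + deriv (ladder ι n (Φ t)) x ^ 2
      + (n : ℝ) * (n + 1) * ι x ^ 2 * ladder ι n (Φ t) x ^ 2 with het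
  have het0 : ∀ t, t₀ ≤ t → ∀ x, B + t < x → et t x = 0 := by
    intro t ht x hx
    have hxR : R + t < x := by linarith
    obtain ⟨h1, h2, h3⟩ := hzero t ht x hx
    simp only [het, hψt_eq t ht x hxR, hψx_eq t ht x hxR, hψ_eq t ht x hxR, h1, h2, h3]
    ring
  -- continuity of the integrand in `x`
  have hψC2 : ContDiff ℝ 2 (Function.uncurry fun t => ladder ι n (Φ t)) :=
    contDiff_uncurry_ladder hι (m := 2) (by rw [add_comm]; exact hΦC)
  obtain ⟨ψt, ψx, -, -, -, hψtc, hψxc, -, -, -, hd1, hd2, -⟩ :=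
    Literature.Analysis.Calculus.exists_partials_of_contDiff_two hψC2
  have het_cont : ∀ t, Continuous (et t) := by
    intro t
    have e : et t = fun x => ψt t x ^ 2 + ψx t x ^ 2
        + (n : ℝ) * (n + 1) * ι x ^ 2 * ladder ι n (Φ t) x ^ 2 := by
      funext x
      simp only [het, (hd1 t x).deriv, (hd2 t x).deriv]
    rw [e]
    have hc3 : Continuous fun x => ladder ι n (Φ t) x :=
      hψC2.continuous.comp (continuous_const.prodMk continuous_id)
    exact (((hψtc.comp (continuous_const.prodMk continuous_id)).pow 2).add
      ((hψxc.comp (continuous_const.prodMk continuous_id)).pow 2)).add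
      (((continuous_const.mul (hι.continuous.pow 2)).mul (hc3.pow 2)))
  have hwindow : ∀ t, t₀ ≤ t → (∫ x in Ioi (R + t), et t x) = ∫ y in R..B, et t (y + t) := by
    intro t ht
    have hle : R + t ≤ B + t := by linarith
    have hI1 : IntegrableOn (et t) (Ioc (R + t) (B + t)) :=
      ((het_cont t).continuousOn.integrableOn_Icc).mono_set Ioc_subset_Icc_self
    have hI2 : IntegrableOn (et t) (Ioi (B + t)) :=
      integrableOn_zero.congr_fun (fun x hx => (het0 t ht x hx).symm) measurableSet_Ioi
    rw [← Ioc_union_Ioi_eq_Ioi hle, setIntegral_union (Ioc_disjoint_Ioi le_rfl)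
      measurableSet_Ioi hI1 hI2]
    have hz : (∫ x in Ioi (B + t), et t x) = 0 :=
      setIntegral_eq_zero_of_forall_eq_zero fun x (hx : x ∈ Ioi (B + t)) => het0 t ht x hx
    rw [hz, add_zero, ← intervalIntegral.integral_of_le hle,
      ← intervalIntegral.integral_comp_add_right]
  -- Step 4: dominated convergence on the window `[R, B]`
  have hrep : ∀ t, t₀ ≤ t → ∀ y ∈ Ioc R B, et t (y + t)
      = (-(iteratedDeriv (n + 1) w y + ε₄ t y)) ^ 2
        + (iteratedDeriv (n + 1) w y + ε₂ t y
            + ((n : ℝ) + 1) * (y + t)⁻¹ * (iteratedDeriv n w y + ε₁ t y)) ^ 2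
        + (n : ℝ) * (n + 1) * (y + t)⁻¹ ^ 2 * (iteratedDeriv n w y + ε₁ t y) ^ 2 := by
    intro t ht y hy
    have hx : R + t < y + t := by linarith [hy.1]
    have ht1 : 1 ≤ t := by rw [ht₀] at ht; linarith
    have hιz : ι (y + t) = (y + t)⁻¹ := hιeq _ (by linarith [hy.1])
    simp only [het, hψt_eq t ht _ hx, hψx_eq t ht _ hx, hψ_eq t ht _ hx, hε₁, hε₂, hε₄, hιz]
    ring
  have hshift : ∀ y : ℝ, Tendsto (fun t : ℝ => y + t) atTop atTop := fun y =>
    tendsto_atTop_add_const_left _ _ tendsto_id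
  have hKdiv : ∀ y : ℝ, Tendsto (fun t : ℝ => K / (y + t)) atTop (𝓝 0) := fun y =>
    tendsto_const_nhds.div_atTop (hshift y)
  have hinv : ∀ y : ℝ, Tendsto (fun t : ℝ => (y + t)⁻¹) atTop (𝓝 0) := fun y =>
    tendsto_inv_atTop_zero.comp (hshift y)
  have hεlim : ∀ y ∈ Ioc R B, Tendsto (fun t => ε₁ t y) atTop (𝓝 0) ∧
      Tendsto (fun t => ε₂ t y) atTop (𝓝 0) ∧ Tendsto (fun t => ε₄ t y) atTop (𝓝 0) := by
    intro y hy
    have hev : ∀ᶠ t in atTop, t₀ ≤ t := Filter.eventually_ge_atTop t₀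
    refine ⟨squeeze_zero_norm' ?_ (hKdiv y), squeeze_zero_norm' ?_ (hKdiv y),
      squeeze_zero_norm' ?_ (hKdiv y)⟩
    · filter_upwards [hev] with t ht; rw [Real.norm_eq_abs]; exact (hwin t ht y hy).1
    · filter_upwards [hev] with t ht; rw [Real.norm_eq_abs]; exact (hwin t ht y hy).2.1
    · filter_upwards [hev] with t ht; rw [Real.norm_eq_abs]; exact (hwin t ht y hy).2.2
  have hlim : ∀ y ∈ Ioc R B,
      Tendsto (fun t => et t (y + t)) atTop (𝓝 (2 * iteratedDeriv (n + 1) F y ^ 2)) := by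
    intro y hy
    obtain ⟨h1, h2, h4⟩ := hεlim y hy
    set A : ℝ := iteratedDeriv (n + 1) w y with hA
    set P : ℝ := iteratedDeriv n w y with hP
    have key : Tendsto (fun t => (-(A + ε₄ t y)) ^ 2
        + (A + ε₂ t y + ((n : ℝ) + 1) * (y + t)⁻¹ * (P + ε₁ t y)) ^ 2
        + (n : ℝ) * (n + 1) * (y + t)⁻¹ ^ 2 * (P + ε₁ t y) ^ 2) atTop
        (𝓝 ((-(A + 0)) ^ 2 + (A + 0 + ((n : ℝ) + 1) * 0 * (P + 0)) ^ 2
          + (n : ℝ) * (n + 1) * 0 ^ 2 * (P + 0) ^ 2)) :=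
      (((tendsto_const_nhds.add h4).neg.pow 2).add
        (((tendsto_const_nhds.add h2).add
          ((tendsto_const_nhds.mul (hinv y)).mul (tendsto_const_nhds.add h1))).pow 2)).add
        ((tendsto_const_nhds.mul ((hinv y).pow 2)).mul ((tendsto_const_nhds.add h1).pow 2))
    have hval : (-(A + 0)) ^ 2 + (A + 0 + ((n : ℝ) + 1) * 0 * (P + 0)) ^ 2
        + (n : ℝ) * (n + 1) * 0 ^ 2 * (P + 0) ^ 2 = 2 * iteratedDeriv (n + 1) F y ^ 2 := by
      rw [hA, hdw n]; ring
    rw [← hval]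
    refine key.congr' ?_
    filter_upwards [Filter.eventually_ge_atTop t₀] with t ht
    exact (hrep t ht y hy).symm
  set Cb : ℝ := (M + K) ^ 2 + (M + K + ((n : ℝ) + 1) * (M + K)) ^ 2
    + (n : ℝ) * (n + 1) * (M + K) ^ 2 with hCb
  have hdom : ∀ t, t₀ ≤ t → ∀ y ∈ Ioc R B, |et t (y + t)| ≤ Cb := by
    intro t ht y hy
    have hyI : y ∈ Icc R B := ⟨hy.1.le, hy.2⟩
    have ht1 : 1 ≤ t := by rw [ht₀] at ht; linarith
    have hz1 : 1 ≤ y + t := by linarith [hy.1]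
    have hz0 : 0 < y + t := by linarith
    obtain ⟨b1, b2, b4⟩ := hwin t ht y hy
    have hKz : K / (y + t) ≤ K := div_le_self hK0 hz1
    have e1 : |ε₁ t y| ≤ K := b1.trans hKz
    have e2 : |ε₂ t y| ≤ K := b2.trans hKz
    have e4 : |ε₄ t y| ≤ K := b4.trans hKz
    have hAM : |iteratedDeriv (n + 1) w y| ≤ M := hM y hyI (n + 1) (mem_range.2 (by omega))
    have hPM : |iteratedDeriv n w y| ≤ M := hM y hyI n (mem_range.2 (by omega))
    have hi0 : 0 ≤ (y + t)⁻¹ := inv_nonneg.2 hz0.le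
    have hi1 : (y + t)⁻¹ ≤ 1 := inv_le_one_of_one_le₀ hz1
    set A : ℝ := iteratedDeriv (n + 1) w y
    set P : ℝ := iteratedDeriv n w y
    have hq1 : |A + ε₄ t y| ≤ M + K := (abs_add_le _ _).trans (add_le_add hAM e4)
    have hPe : |P + ε₁ t y| ≤ M + K := (abs_add_le _ _).trans (add_le_add hPM e1)
    have hq2 : |A + ε₂ t y + ((n : ℝ) + 1) * (y + t)⁻¹ * (P + ε₁ t y)|
        ≤ M + K + ((n : ℝ) + 1) * (M + K) := by
      refine (abs_add_le _ _).trans (add_le_add ((abs_add_le _ _).trans (add_le_add hAM e2)) ?_)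
      rw [abs_mul, abs_mul, abs_of_nonneg hi0, abs_of_nonneg (by positivity : (0 : ℝ) ≤ n + 1)]
      calc ((n : ℝ) + 1) * (y + t)⁻¹ * |P + ε₁ t y| ≤ ((n : ℝ) + 1) * 1 * (M + K) :=
            mul_le_mul (mul_le_mul_of_nonneg_left hi1 (by positivity)) hPe (abs_nonneg _)
              (by positivity)
        _ = ((n : ℝ) + 1) * (M + K) := by ring
    have hMK : 0 ≤ M + K := by positivity
    have s1 : (-(A + ε₄ t y)) ^ 2 ≤ (M + K) ^ 2 := by
      rw [neg_sq, ← sq_abs]; exact pow_le_pow_left₀ (abs_nonneg _) hq1 2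
    have s2 : (A + ε₂ t y + ((n : ℝ) + 1) * (y + t)⁻¹ * (P + ε₁ t y)) ^ 2
        ≤ (M + K + ((n : ℝ) + 1) * (M + K)) ^ 2 := by
      rw [← sq_abs]; exact pow_le_pow_left₀ (abs_nonneg _) hq2 2
    have s3 : (n : ℝ) * (n + 1) * (y + t)⁻¹ ^ 2 * (P + ε₁ t y) ^ 2
        ≤ (n : ℝ) * (n + 1) * (M + K) ^ 2 := by
      have hPe2 : (P + ε₁ t y) ^ 2 ≤ (M + K) ^ 2 := by
        rw [← sq_abs]; exact pow_le_pow_left₀ (abs_nonneg _) hPe 2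
      have hi2 : (y + t)⁻¹ ^ 2 ≤ 1 := pow_le_one₀ hi0 hi1
      calc (n : ℝ) * (n + 1) * (y + t)⁻¹ ^ 2 * (P + ε₁ t y) ^ 2
          ≤ (n : ℝ) * (n + 1) * 1 * (M + K) ^ 2 :=
            mul_le_mul (mul_le_mul_of_nonneg_left hi2 (by positivity)) hPe2 (sq_nonneg _)
              (by positivity)
        _ = (n : ℝ) * (n + 1) * (M + K) ^ 2 := by ring
    rw [hrep t ht y hy, abs_of_nonneg (by positivity)]
    linarith [s1, s2, s3]
  have hDCT : Tendsto (fun t => ∫ y in R..B, et t (y + t)) atTop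
      (𝓝 (∫ y in R..B, 2 * iteratedDeriv (n + 1) F y ^ 2)) := by
    refine intervalIntegral.tendsto_integral_filter_of_dominated_convergence (fun _ => Cb)
      ?_ ?_ ?_ ?_
    · exact Filter.Eventually.of_forall fun t =>
        ((het_cont t).comp (continuous_id.add continuous_const)).aestronglyMeasurable
    · filter_upwards [Filter.eventually_ge_atTop t₀] with t ht
      refine ae_of_all _ fun y hy => ?_
      rw [uIoc_of_le hRB] at hy
      rw [Real.norm_eq_abs]; exact hdom t ht y hy
    · exact intervalIntegrable_const
    · refine ae_of_all _ fun y hy => ?_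
      rw [uIoc_of_le hRB] at hy
      exact hlim y hy
  rw [show (2 * ∫ y in R..B, iteratedDeriv (n + 1) F y ^ 2)
      = ∫ y in R..B, 2 * iteratedDeriv (n + 1) F y ^ 2 from
    (intervalIntegral.integral_const_mul 2 _).symm]
  refine hDCT.congr' ?_
  filter_upwards [Filter.eventually_ge_atTop t₀] with t ht
  exact (hwindow t ht).symm

end Literature.Analysis.PDE
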